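import Summits.ABC.IUTFork.Conditional.WRowHexLamSevenInhLe40M
import Summits.ABC.IUTFork.Cor312HullLicenceLabelZeroM
import Summits.ABC.IUTFork.Conditional.AbcOfSGenuineM
import HarnessLib

/-!
# HEX family, M LINE: the INHABITED side `k = 1…40`, `l ≥ L⁺(k)` IN THE M BOOKS' OWN BINDER SHAPE (hull form, the datum's OWN ideles, pinned
# q-reading) under ONE NAME — the M twin of abc-iut-C-cert-1's `WRow.hex_whole_le_40_hull` (p544075) and the exact un-negated shape of
# abc-iut-W-neg-1's refuted-side `GenuineM.hex_ref_le_40_M` (p545466)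

PROOF-ONLY file (D-0012; 0 definitions, 0 `Prop` facts, no instance, no notation) of the abc-iut cell — branch C certificate seat abc-iut-C-cert-2
(gen 9), standing duty (e) («M twin of every new K-line INHABITED theorem»; here of `WRow.hex_whole_le_40_hull`). TAKES NO SIDE on [IUTchIII] Cor. 3.12
(S. Mochizuki, *Inter-universal Teichmüller theory III*, Cor. 3.12 p. 173–174; Step (xi-f) p. 184) or on any author; «inhabited as typed» ≠ «asserted
in print».

THIS FILE: ONE theorem **`WRowM.hex_inh_le_40_hull_M`** — for `(k, L⁺)` in the 40-row list literal of its binder (the `(k, L⁺)` columns of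
`WRow.hex_whole_le_40` p543048 VERBATIM, = the binder of `WRowM.hex_inh_le_40_M` p547486), every prime `l ≥ L⁺` and every genuine Θ-volume datum `T` over
`(ratPoint (1/2 + 2/7^k), l)`: the M books' per-datum S_H OBJECT ITSELF — the conclusion of the binder `hSHwC` of `Conditional.abc_of_SH_v11M_window_content`
(and of `hSHw` / `hSHwBad` of its siblings): `Cor312Vol.PilotKummerCompatHull (LatticeSituation.ofShells (logShellsOfInitialDH T.D (analyticLogvVal T.K)) …)
(settingPrVolSharpM T.D … (tOfIdeleData T.D (ideleDataOf T.D T.isVolumeInputOf)) (tqM … (ideleDataOf T.D T.isVolumeInputOf) …) … Sθ …) (fun _ => qRegion …) qK`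
— HOLDS for every context binder `M, archPk, …, thetaDiv, n, lat, sig, split, qData` and every Kummer binder `qK`. The statement is abc-iut-W-neg-1's
`GenuineM.hex_ref_le_40_M` with the `¬` removed and the `(k, L₀)` table replaced by the `(k, L⁺)` table — so on the M line the two sides of every HEX axis
now face each other IN ONE SHAPE under two names. PROOF (two landed names, nothing re-derived): this seat's licence-form packaging `WRowM.hex_inh_le_40_M`
(p547486) at `logvK := analyticLogvVal T.K`, `r := ideleDataOf T.D T.isVolumeInputOf`, `Sq := Sθ`, transported to the hull form by abc-iut-C-cert-2 gen 5's
M junction `Thm311.Real.pilotKummerCompatHull_settingPrVolSharpM_tqM_iff_licence` (`Cor312HullLicenceLabelZeroM`, p485897; S_H,M ≡ (xi-f) Licence at the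
own-ideles setting, `‖t_q‖ ≤ 1` by `norm_tqM_le_one`), exactly as abc-iut-C-cert-2 gen 7's `FamilyM` files do per triple.
READING (neutral; numbers, not adjectives): at every `(λ_k, l)`, `k ≤ 40`, prime `l ≥ L⁺(k)`, the M books' S_H binder is INHABITED AS TYPED at every
genuine datum IN ITS OWN SHAPE; with `GenuineM.hex_ref_le_40_M` (`11 ≤ l ≤ L₀(k)`: the same object FAILS) the M line's HEX dichotomy is literal.
Admissibility / Szpiro-badness / (P6) of `(ratPoint λ_k, l)` and NON-EMPTINESS of the datum type are NOT claimed; a twin / packaging theorem discharges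
nothing new; the explicit hypothesis counts of the record books are UNCHANGED. HONEST SCOPE: OUR sharp containers and Dupuy–Hilado's typed (Ind1)/(Ind2);
STRONGER-THAN-PRINT set-level reading of Step (xi-f); nothing about the printed GLOBAL inequality, the number-level `Cor22.Cor312AtDatum` or any author's
intended hull; typed ≠ proved; instantiated ≠ endorsed; no abc claim. [cite: Mochizuki2012, IUTchI Def. 3.1 (e) p. 62, Ex. 3.2 (iv) p. 71; IUTchIII
Cor. 3.12 Step (xi-f) p. 184; IUTchIV Prop. 1.1 p. 9, Prop. 1.2 (i)(ii) p. 10, Cor. 2.2 (ii) proof (P5) p. 46] [cite: DupuyHilado2025, §3.3, §3.4, §3.7, §3.9,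
§4.9, §4.12] [claim: Mochizuki2012, status: disputed] for every IUT sentence.
-/

noncomputable section

open Set Function Metric NumberField IsDedekindDomain

namespace Summit.ABC.IUTFork.Conditional

open Thm311 Thm311.Real Cor312 Cor312Vol Cor312Prov Literature.IUT.LogThetaLattice Literature.IUT.LogVolume
  Literature.IUT.HodgeTheaters Literature.IUT.LogVolume.ThetaData Literature.IUT.LogVolume.Cor22
open Literature.NumberTheory.NumberFields Literature.NumberTheory.GaloisRepresentations.Ultrametric
open Literature.NumberTheory.DiophantineGeometry Literature.NumberTheory.DiophantineGeometry.GenEll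

/-- **«HEX INHABITED SIDE, M LINE, IN THE M BOOKS' OWN BINDER SHAPE, k = 1…40 UNDER ONE NAME».** For every row `(k, L⁺)` of the 40-row list literal
below (VERBATIM the `(k, L⁺)` columns of `WRow.hex_whole_le_40`), every prime `l ≥ L⁺` and every genuine Θ-volume datum `T` over
`(ratPoint (1/2 + 2/7^k), l)`: `Cor312Vol.PilotKummerCompatHull` at the summand-route M-level setting of `T`'s OWN ideles with the pinned q-reading —
the conclusion of the M books' binder `hSHwC` / `hSHw` — for every context and Kummer binder; = `GenuineM.hex_ref_le_40_M`'s statement un-negated.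
From `WRowM.hex_inh_le_40_M` (p547486) by the M junction `pilotKummerCompatHull_settingPrVolSharpM_tqM_iff_licence` (p485897). The refuted side,
admissibility / (P6) / non-emptiness are NOT claimed; inhabited-as-typed only. [cite: Mochizuki2012, IUTchIII Cor. 3.12 Step (xi-f) p. 184; IUTchIV
Prop. 1.2 (i)(ii) p. 10, Cor. 2.2 (ii) proof (P5) p. 46] [cite: DupuyHilado2025, §3.7, §3.9, §4.9, §4.12] [claim: Mochizuki2012, status: disputed] -/
theorem WRowM.hex_inh_le_40_hull_M {k Lp l : ℕ}
    (hmem : (k, Lp) ∈ ([(1, 11), (2, 11), (3, 11), (4, 11), (5, 11), (6, 11), (7, 11), (8, 73), (9, 347), (10, 4723), (11, 821), (12, 20071), (13, 5857), (14, 46957), (15, 617647), (16, 329281), (17, 288209), (18, 6917611), (19, 2017643), (20, 80707051), (21, 42371257), (22, 112989913), (23, 98866289), (24, 2372791903), (25, 3460321747), (26, 5536514681), (27, 14533351507), (28, 38755603927), (29, 33911153599), (30, 4069338436831), (31, 237378075439), (32, 1899024603703), (33, 4984939585387), (34, 13293172227557), (35, 58157628496739), (36, 279156616784387), (37, 81420679895459),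 (38, 651365439163849), (39, 1709834277805961), (40, 22797790370745947)] : List (ℕ × ℕ)))
    (hl : l.Prime) (hLp : Lp ≤ l)
    (T : Cor22.ThetaVolumeDatumAt (ratPoint ((2 : ℚ)⁻¹ + 2 / 7 ^ k)) l) :
    letI := T.instFieldF; letI := T.instNumberFieldF; letI := T.instAlgebraF; letI := T.instFieldK
    letI := T.instNumberFieldK; letI := T.instAlgebraK; letI := T.instFieldFbar; letI := T.instAlgebraFbar
    letI := T.instAlgebraKFbar; letI := T.instIsElliptic
    ∀ (M : Type) [Field M] [NumberField M]
      (archPk : ∀ (j : (thetaIndexOfInitial T.D).Label) (vQ : (thetaIndexOfInitial T.D).VQ),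
        Set ((logShellsOfInitialDH T.D (analyticLogvVal T.K)).Packet j vQ))
      (archSub : ∀ (j : (thetaIndexOfInitial T.D).Label) (v : (thetaIndexOfInitial T.D).V),
        Set ((logShellsOfInitialDH T.D (analyticLogvVal T.K)).Packet j ((thetaIndexOfInitial T.D).over v)))
      (Ψ : ℤ → ∀ v : (thetaIndexOfInitial T.D).V, v ∈ (thetaIndexOfInitial T.D).Vbad →
        Set ((logShellsOfInitialDH T.D (analyticLogvVal T.K)).StarPacket v))
      (act : ℤ → ∀ v : (thetaIndexOfInitial T.D).V, v ∈ (thetaIndexOfInitial T.D).Vbad →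
        (logShellsOfInitialDH T.D (analyticLogvVal T.K)).StarPacket v →
          Module.End ℚ ((logShellsOfInitialDH T.D (analyticLogvVal T.K)).StarPacket v))
      (Mmod : ℤ → ∀ j : (thetaIndexOfInitial T.D).LabelStar, Set ((logShellsOfInitialDH T.D (analyticLogvVal T.K)).GlobalPacket j.1))
      (region : ℤ → ∀ j : (thetaIndexOfInitial T.D).LabelStar, FinDivisor M → ∀ vQ : (thetaIndexOfInitial T.D).VQ,
        Set ((logShellsOfInitialDH T.D (analyticLogvVal T.K)).Packet j.1 vQ))
      (frobAdm : ℤ → ℤ → ∀ (j : (thetaIndexOfInitial T.D).Label) (vQ : (thetaIndexOfInitial T.D).VQ),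
        Set ((logShellsOfInitialDH T.D (analyticLogvVal T.K)).Packet j vQ) → Prop)
      (frobLogvol : ℤ → ℤ → ∀ (j : (thetaIndexOfInitial T.D).Label) (vQ : (thetaIndexOfInitial T.D).VQ),
        Set ((logShellsOfInitialDH T.D (analyticLogvVal T.K)).Packet j vQ) → ℝ)
      (frobΨ : ℤ → ℤ → ∀ v : (thetaIndexOfInitial T.D).V, v ∈ (thetaIndexOfInitial T.D).Vbad →
        Set ((logShellsOfInitialDH T.D (analyticLogvVal T.K)).StarPacket v))
      (frobMmod : ℤ → ℤ → ∀ j : (thetaIndexOfInitial T.D).LabelStar, Set ((logShellsOfInitialDH T.D (analyticLogvVal T.K)).GlobalPacket j.1))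
      (unitImage : ℤ → ℤ → ℕ → ∀ (j : (thetaIndexOfInitial T.D).Label) (vQ : (thetaIndexOfInitial T.D).VQ),
        Set ((logShellsOfInitialDH T.D (analyticLogvVal T.K)).Packet j vQ))
      (ballImage : ℤ → ℤ → ∀ (j : (thetaIndexOfInitial T.D).Label) (vQ : (thetaIndexOfInitial T.D).VQ),
        Set ((logShellsOfInitialDH T.D (analyticLogvVal T.K)).Packet j vQ))
      (thetaDiv : ℤ → ℤ → LgpDivisor M (thetaIndexOfInitial T.D).lstar)
      (n : ℤ) {HT : Type} {LogLink : HT → HT → Type} {IsFull : ∀ {s t : HT}, LogLink s t → Prop}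
      (lat : LGPGaussianLogThetaLattice LogLink IsFull)
      {Frd : Type} {IsoF : Frd → Frd → Type} {Ob : Frd → Type} {realify : Frd → Frd} {Strip : Type}
      {IsoS : Strip → Strip → Type} {Mv : ∀ v : (thetaIndexOfInitial T.D).V, v ∈ (thetaIndexOfInitial T.D).Vbad → Type}
      [∀ v h, Monoid (Mv v h)]
      (sig : GlobalLGPFrobenioidSignature (thetaIndexOfInitial T.D).lstar (thetaIndexOfInitial T.D).V
        (· ∈ (thetaIndexOfInitial T.D).Vbad) Frd IsoF Ob realify Strip IsoS Mv)
      (split : SplittingMonoids Mv) {ObΔ : Type} {N : ∀ v : (thetaIndexOfInitial T.D).V, v ∈ (thetaIndexOfInitial T.D).Vbad → Type}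
      [∀ v h, Monoid (N v h)] (qData : QPilotData ObΔ N)
      (qK : ∀ v : (thetaIndexOfInitial T.D).V, v ∈ (thetaIndexOfInitial T.D).Vbad →
        Set ((logShellsOfInitialDH T.D (analyticLogvVal T.K)).StarPacket v)),
      Cor312Vol.PilotKummerCompatHull
        (LatticeSituation.ofShells (logShellsOfInitialDH T.D (analyticLogvVal T.K)) M archPk archSub
          (summandPiecesPrM T.D (logvAnalyticVal_analyticLogvVal (K := T.K))).Adm (summandPiecesPrM T.D (logvAnalyticVal_analyticLogvVal (K := T.K))).logvol Ψ act Mmod region frobAdm frobLogvol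
          frobΨ frobMmod unitImage ballImage thetaDiv)
        (settingPrVolSharpM T.D (logvAnalyticVal_analyticLogvVal (K := T.K)) (tOfIdeleData T.D (ideleDataOf T.D T.isVolumeInputOf))
          (fun u x => tqM T.D (ratChar u) u (natCast_ratChar_mem u) (ideleDataOf T.D T.isVolumeInputOf) x) M archPk archSub Ψ act Mmod region n lat sig split qData
          (fun u x => tqM_ne_zero T.D (ratChar u) u (natCast_ratChar_mem u) (ideleDataOf T.D T.isVolumeInputOf) x)
          (GenuineM.finite_ratPlaces_under_S T.D).toFinset
          (fun u x hu => norm_tqM_eq_one_of_not_mem T.D (ratChar u) u (natCast_ratChar_mem u) (ideleDataOf T.D T.isVolumeInputOf) x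
            fun hx => hu ((Set.Finite.mem_toFinset _).mpr ⟨x, hx⟩)))
        (fun _ => Cor312.Setting.qRegion
          (settingPrVolSharpM T.D (logvAnalyticVal_analyticLogvVal (K := T.K)) (tOfIdeleData T.D (ideleDataOf T.D T.isVolumeInputOf))
          (fun u x => tqM T.D (ratChar u) u (natCast_ratChar_mem u) (ideleDataOf T.D T.isVolumeInputOf) x) M archPk archSub Ψ act Mmod region n lat sig split qData
          (fun u x => tqM_ne_zero T.D (ratChar u) u (natCast_ratChar_mem u) (ideleDataOf T.D T.isVolumeInputOf) x)
          (GenuineM.finite_ratPlaces_under_S T.D).toFinset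
          (fun u x hu => norm_tqM_eq_one_of_not_mem T.D (ratChar u) u (natCast_ratChar_mem u) (ideleDataOf T.D T.isVolumeInputOf) x
            fun hx => hu ((Set.Finite.mem_toFinset _).mpr ⟨x, hx⟩)))) qK := by
  intro M _ _ archPk archSub Ψ act Mmod region frobAdm frobLogvol frobΨ frobMmod unitImage ballImage thetaDiv n HT LogLink IsFull lat
    Frd IsoF Ob realify Strip IsoS Mv _ sig split ObΔ N _ qData qK
  letI := T.instFieldF; letI := T.instNumberFieldF; letI := T.instAlgebraF; letI := T.instFieldK
  letI := T.instNumberFieldK; letI := T.instAlgebraK; letI := T.instFieldFbar; letI := T.instAlgebraFbar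
  letI := T.instAlgebraKFbar; letI := T.instIsElliptic
  exact (pilotKummerCompatHull_settingPrVolSharpM_tqM_iff_licence T.D (logvAnalyticVal_analyticLogvVal (K := T.K)) M
    archPk archSub Ψ act Mmod region n lat sig split qData (tOfIdeleData T.D (ideleDataOf T.D T.isVolumeInputOf)) (ideleDataOf T.D T.isVolumeInputOf)
    (GenuineM.finite_ratPlaces_under_S T.D).toFinset
    (fun u x hu => norm_tqM_eq_one_of_not_mem T.D (ratChar u) u (natCast_ratChar_mem u) (ideleDataOf T.D T.isVolumeInputOf) x
      fun hx => hu ((Set.Finite.mem_toFinset _).mpr ⟨x, hx⟩))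
    frobAdm frobLogvol frobΨ frobMmod unitImage ballImage thetaDiv qK).2
    (WRowM.hex_inh_le_40_M hmem hl hLp T (logvAnalyticVal_analyticLogvVal (K := T.K)) (ideleDataOf T.D T.isVolumeInputOf) M
      archPk archSub Ψ act Mmod region n lat sig split qData _ _ _)

end Summit.ABC.IUTFork.Conditional

end
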